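import Summits.QuantumFields.YangMills.Theses.HyperbolicRegulator

/-!
# Route `HyperbolicRegulator`, crux `CurvatureUniformityR` (stmt-QuantumFields-18154): the TAME / CONE-CHART split

Crux-strategist decomposition (`planner-cstrat-stmt-QuantumFields-18154-b1-0`, 2026-08-17):

  `TameCoreUniformityR → ConeChartsOfAdmissible → CurvatureUniformityR`.

* `TameCoreUniformityR` — the crux VERBATIM, restricted to admissible hyperbolic families that carry CONE CHARTS: a new
  datum `cK : ℕ → ℕ → ℕ → Fin 5 → ℕ × ℕ → ℕ` (per `k`, `j`: cone `c`, quadrant `s : Fin 5`, coordinates `(a, b)`) and the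
  hypothesis that at every degree-5 vertex `c` the five quadrant charts of radius `k/2` are injective, send model edges /
  unit squares to edges / squares and are ONTO the graph ball `B(c, k/2)` (restate advice R-b of
  `Cruxes/CurvatureUniformity/RESTATE-ADVICE.md`, clause typed in `Cruxes/CurvatureUniformity/StrategistSketch.lean`).  This is the
  statement the thesis MEANS (finite square surfaces locally modelled on `{4,5}_k` everywhere); it still contains the
  weak-coupling volume-uniform lattice gap (Chatterjee Problem 5.1), now reachable by LOCAL techniques (finite-size windows
  + disagreement percolation on the bounded-degree cell graph of `S × S` with sparse corner defects).
* `ConeChartsOfAdmissible` — `G`-free combinatorial rigidity: EVERY single admissible complex (`k ≥ 8`, any `j`) admits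
  cone charts.  Believed FALSE (the strategist's "periscope" cores: a `C₂ ⊔ C₂` pinch inside the uncharted core of a cone is
  compatible with all nine admissibility clauses; explicit candidate `(Bring {4,5}_k)/ℤ₅` with four periscopes at `k = 8`,
  `j = 0`); its refutation certifies that the typed family class of the parent is larger than intended and forces the R-b
  restate, whose repaired text is `TameCoreUniformityR` itself.
* `CurvatureUniformityR_of_subs` — the glue (choice of cone charts per `(k, j)`, then the tame crux), sorry-free.

Both children are stated FULLY INLINED (the route file imports only Mathlib / HarnessLib / Statement / LatticeGaugeDLR), with
`let`-preambles byte-identical to the parent's so that hypotheses pass across by ζ/β/proj-reduction exactly as in `closes`.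
-/

set_option autoImplicit false

namespace Summit.QuantumFields.YangMills.Cruxes.CurvatureUniformityR.ConeTameSplit

/-- **Child 1 (crux, rank 2) — `TameCoreUniformityR`.**  `CurvatureUniformityR` verbatim, for admissible hyperbolic
families equipped with cone charts `cK` satisfying the cone-chart clause `CC` at every `k ≥ 8`, `j`. -/
def TameCoreUniformityR : Prop :=
  open Literature.MathematicalPhysics.QuantumFieldTheory Literature.MathematicalPhysics.QuantumLattice MeasureTheory in ∀ (G : Type) [Group G] [TopologicalSpace G] [IsTopologicalGroup G] [CompactSpace G], IsCompactSimpleLieGroup G → letI : MeasurableSpace G := borel G; haveI : BorelSpace G := ⟨rfl⟩; ∀ r : LatticeRep G, let Fam := fun (k j : ℕ) (V E Q : Finset ℕ) (σ τ : ℕ → ℕ) (bd : ℕ → Fin 4 → ℕ × Bool) (cV : ℕ → ℤ × ℤ → ℕ) (cE : ℕ → ℤ × ℤ → Fin 2 → ℕ × Bool) => let st := fun e : ℕ × Bool => if e.2 then σ e.1 else τ e.1; let en := fun e : ℕ × Bool => if e.2 then τ e.1 else σ e.1; let Γ := SimpleGraph.fromRel fun a b : ℕ => ∃ e ∈ E,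 σ e = a ∧ τ e = b; let dg := fun x : ℕ => (E.filter fun e => σ e = x ∨ τ e = x).card; let K := V.filter fun x => dg x = 5; let F := fun x : ℕ => x ∈ V ∧ ∀ c ∈ K, k / 2 < Γ.dist x c; let Dp := fun x : ℕ => x ∈ V ∧ ∀ c ∈ K, 3 * (k / 4) < Γ.dist x c; let ib := fun a : ℤ × ℤ => |a.1| ≤ (k : ℤ) / 4 ∧ |a.2| ≤ (k : ℤ) / 4; let nx := fun (a : ℤ × ℤ) (μ : Fin 2) => if μ = 0 then (a.1 + 1, a.2) else (a.1, a.2 + 1); let Ed := (ℕ × ℕ) ⊕ (ℕ × ℕ); let PE : Finset Ed := (E ×ˢ V).disjSum (V ×ˢ E); let Cfg := ↥PE → G; let ν := Measure.pi fun _ : ↥PE => haarProbability G; let v := fun (U : Cfg) (e : Ed × Bool) => if h : e.1 ∈ PE then (if e.2 then U ⟨e.1, h⟩ else (U ⟨e.1, h⟩)⁻¹) else 1; let w := fun (U : Cfg) (e : Fin 4 → Ed × Bool) => (r.ρ (v U (e 0) * v U (e 1) * v U (e 2) * v U (e 3))).trace.re; let S := fun U : Cfg => (∑ q ∈ Q,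 ∑ y ∈ V, w U fun i => (Sum.inl ((bd q i).1, y), (bd q i).2)) + (∑ y ∈ V, ∑ q ∈ Q, w U fun i => (Sum.inr (y, (bd q i).1), (bd q i).2)) + ∑ e ∈ E, ∑ e' ∈ E, w U ![(Sum.inl (e, σ e'), true), (Sum.inr (τ e, e'), true), (Sum.inl (e, τ e'), false), (Sum.inr (σ e, e'), false)]; let d0 : Fin 4 → Fin 2 := ![0, 1, 0, 1]; let P := fun (x x' : ℕ) (U : Cfg) (p : ZdEdge 4) => let a := (p.1 0, p.1 1); let b := (p.1 2, p.1 3); if p.2 = 0 ∨ p.2 = 1 then v U (Sum.inl ((cE x a (d0 p.2)).1, cV x' b), (cE x a (d0 p.2)).2) else v U (Sum.inr (cV x a, (cE x' b (d0 p.2)).1), (cE x' b (d0 p.2)).2); ((∀ e ∈ E, σ e ∈ V ∧ τ e ∈ V ∧ σ e ≠ τ e) ∧ (∀ q ∈ Q, (∀ i, (bd q i).1 ∈ E) ∧ (∀ i, en (bd q i) = st (bd q (i + 1))) ∧ (st ∘ bd q).Injective) ∧ (∀ e ∈ E, (Q.filter fun q => ∃ i, (bd q i).1 = e).card = 2) ∧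 (∀ x ∈ V, (dg x = 4 ∨ dg x = 5) ∧ (Q.filter fun q => ∃ i, st (bd q i) = x).card = dg x) ∧ (∀ x ∈ V, ∃ c ∈ K, Γ.dist x c ≤ k) ∧ (∀ c ∈ K, ∀ c' ∈ K, c ≠ c' → k ≤ Γ.dist c c') ∧ (∀ f : ℕ → ℝ, ∑ x ∈ V, f x = 0 → ∑ x ∈ V, f x ^ 2 ≤ 10 ^ 6 * (k : ℝ) ^ 2 * ∑ e ∈ E, (f (σ e) - f (τ e)) ^ 2) ∧ (∃ x y, Dp x ∧ Dp y ∧ j ≤ Γ.dist x y) ∧ (∀ x, F x → cV x (0, 0) = x ∧ (∀ a, ib a → cV x a ∈ V) ∧ Set.InjOn (cV x) {a | ib a} ∧ (∀ a μ, ib a → ib (nx a μ) → (cE x a μ).1 ∈ E ∧ st (cE x a μ) = cV x a ∧ en (cE x a μ) = cV x (nx a μ)) ∧ (∀ a, ib a → ib (a.1 + 1, a.2 + 1) → ∃ q ∈ Q, Finset.univ.image (Prod.fst ∘ bd q) = {(cE x a 0).1, (cE x (nx a 0) 1).1, (cE x (nx a 1) 0).1, (cE x a 1).1})), fun (β m C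 : ℝ) (A B : YMSpecies G) => let X := fun f : Cfg → ℝ => (∫ U, f U * Real.exp (β * S U) ∂ν) / (∫ U, Real.exp (β * S U) ∂ν); ∀ x x' y y', F x → F x' → F y → F y' → |X (fun U => A.F (P x x' U) * B.F (P y y' U)) - X (fun U => A.F (P x x' U)) * X (fun U => B.F (P y y' U))| ≤ C * Real.exp (-(m * ((Γ.dist x y + Γ.dist x' y' : ℕ) : ℝ)))); let Sp := fun (A : YMSpecies G) (R : ℕ) => ∀ p ∈ A.supp, ∀ i, |p.1 i| ≤ (R : ℤ); let CC := fun (k : ℕ) (V E Q : Finset ℕ) (σ τ : ℕ → ℕ) (bd : ℕ → Fin 4 → ℕ × Bool) (cK : ℕ → Fin 5 → ℕ × ℕ → ℕ) => let st := fun e : ℕ × Bool => if e.2 then σ e.1 else τ e.1; let Γ := SimpleGraph.fromRel fun a b : ℕ => ∃ e ∈ E, σ e = a ∧ τ e = b; let dg := fun x : ℕ => (E.filter fun e => σ e = x ∨ τ e = x).card; let K := V.filter fun x => dg x = 5; let R := k / 2; let P := fun (c : ℕ) (s : Fin 5) (a b : ℕ) => if a = 0 ∧ b = 0 then c else if a =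 0 then cK c (s + 1) (b, 0) else cK c s (a, b); ∀ c ∈ K, (∀ (s : Fin 5) (a b : ℕ), a ≤ R → b ≤ R → P c s a b ∈ V) ∧ (∀ (s : Fin 5) (a b : ℕ), 1 ≤ a → a ≤ R → b ≤ R → cK c s (a, b) ≠ c) ∧ (∀ (s s' : Fin 5) (a a' b b' : ℕ), 1 ≤ a → a ≤ R → b ≤ R → 1 ≤ a' → a' ≤ R → b' ≤ R → cK c s (a, b) = cK c s' (a', b') → s = s' ∧ a = a' ∧ b = b') ∧ (∀ (s : Fin 5) (a b : ℕ), a + 1 ≤ R → b ≤ R → Γ.Adj (P c s a b) (P c s (a + 1) b)) ∧ (∀ (s : Fin 5) (a b : ℕ), a ≤ R → b + 1 ≤ R → Γ.Adj (P c s a b) (P c s a (b + 1))) ∧ (∀ (s : Fin 5) (a b : ℕ), a + 1 ≤ R → b + 1 ≤ R → ∃ q ∈ Q, Finset.univ.image (st ∘ bd q) = {P c s a b, P c s (a + 1) b, P c s a (b + 1), P c s (a + 1) (b + 1)}) ∧ (∀ x ∈ V, Γ.dist x c ≤ R → ∃ (s : Fin 5) (a b : ℕ), a + b ≤ R ∧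 P c s a b = x); ∀ (V E Q : ℕ → ℕ → Finset ℕ) (σ τ : ℕ → ℕ → ℕ → ℕ) (bd : ℕ → ℕ → ℕ → Fin 4 → ℕ × Bool) (cV : ℕ → ℕ → ℕ → ℤ × ℤ → ℕ) (cE : ℕ → ℕ → ℕ → ℤ × ℤ → Fin 2 → ℕ × Bool) (cK : ℕ → ℕ → ℕ → Fin 5 → ℕ × ℕ → ℕ), let Φ := fun k j => Fam k j (V k j) (E k j) (Q k j) (σ k j) (τ k j) (bd k j) (cV k j) (cE k j); (∀ k j, 8 ≤ k → (Φ k j).1) → (∀ k j, 8 ≤ k → CC k (V k j) (E k j) (Q k j) (σ k j) (τ k j) (bd k j) (cK k j)) → (∃ c : ℝ, 0 < c ∧ ∀ k, 8 ≤ k → ∃ β₀ : ℝ, ∀ β, β₀ ≤ β → ∀ A B : YMSpecies G, Sp A (k / 8) → Sp B (k / 8) → ∃ C j₀, ∀ j, j₀ ≤ j → (Φ k j).2 β (c / k) C A B) → (∃ β₁ : ℝ, ∀ β, β₁ ≤ β → ∃ m : ℝ, 0 < m ∧ ∀ A B : YMSpecies G, ∃ C : ℝ, ∃ K : ℕ,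 ∀ k, K ≤ k → Sp A (k / 8) → Sp B (k / 8) → ∃ j₀ : ℕ, ∀ j, j₀ ≤ j → (Φ k j).2 β m C A B)

/-- **Child 2 (crux, rank 3) — `ConeChartsOfAdmissible`.**  Every admissible finite square complex (the parent's inlined
admissibility predicate at scale `k ≥ 8`, separation index `j`) admits cone charts: an injective 5-quadrant chart of radius
`k/2` at every degree-5 vertex, model edges/squares to edges/squares, onto the ball `B(c, k/2)`.  `G`-free.  Believed
FALSE (periscope cores); filed as the cheapest decisive check on the parent's family class. -/
def ConeChartsOfAdmissible : Prop :=
  ∀ (k j : ℕ) (V E Q : Finset ℕ) (σ τ : ℕ → ℕ) (bd : ℕ → Fin 4 → ℕ × Bool) (cV : ℕ → ℤ × ℤ → ℕ) (cE : ℕ → ℤ × ℤ → Fin 2 → ℕ × Bool), 8 ≤ k → (let st := fun e : ℕ × Bool => if e.2 then σ e.1 else τ e.1; let en := fun e : ℕ × Bool => if e.2 then τ e.1 else σ e.1; let Γ := SimpleGraph.fromRel fun a b : ℕ => ∃ e ∈ E, σ e = a ∧ τ e = b; let dg := fun x : ℕ => (E.filter fun e => σ e = x ∨ τ e = x).card;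 let K := V.filter fun x => dg x = 5; let F := fun x : ℕ => x ∈ V ∧ ∀ c ∈ K, k / 2 < Γ.dist x c; let Dp := fun x : ℕ => x ∈ V ∧ ∀ c ∈ K, 3 * (k / 4) < Γ.dist x c; let ib := fun a : ℤ × ℤ => |a.1| ≤ (k : ℤ) / 4 ∧ |a.2| ≤ (k : ℤ) / 4; let nx := fun (a : ℤ × ℤ) (μ : Fin 2) => if μ = 0 then (a.1 + 1, a.2) else (a.1, a.2 + 1); (∀ e ∈ E, σ e ∈ V ∧ τ e ∈ V ∧ σ e ≠ τ e) ∧ (∀ q ∈ Q, (∀ i, (bd q i).1 ∈ E) ∧ (∀ i, en (bd q i) = st (bd q (i + 1))) ∧ (st ∘ bd q).Injective) ∧ (∀ e ∈ E, (Q.filter fun q => ∃ i, (bd q i).1 = e).card = 2) ∧ (∀ x ∈ V, (dg x = 4 ∨ dg x = 5) ∧ (Q.filter fun q => ∃ i, st (bd q i) = x).card = dg x) ∧ (∀ x ∈ V, ∃ c ∈ K, Γ.dist x c ≤ k) ∧ (∀ c ∈ K, ∀ c' ∈ K, c ≠ c' → k ≤ Γ.dist c c') ∧ (∀ f : ℕ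 → ℝ, ∑ x ∈ V, f x = 0 → ∑ x ∈ V, f x ^ 2 ≤ 10 ^ 6 * (k : ℝ) ^ 2 * ∑ e ∈ E, (f (σ e) - f (τ e)) ^ 2) ∧ (∃ x y, Dp x ∧ Dp y ∧ j ≤ Γ.dist x y) ∧ (∀ x, F x → cV x (0, 0) = x ∧ (∀ a, ib a → cV x a ∈ V) ∧ Set.InjOn (cV x) {a | ib a} ∧ (∀ a μ, ib a → ib (nx a μ) → (cE x a μ).1 ∈ E ∧ st (cE x a μ) = cV x a ∧ en (cE x a μ) = cV x (nx a μ)) ∧ (∀ a, ib a → ib (a.1 + 1, a.2 + 1) → ∃ q ∈ Q, Finset.univ.image (Prod.fst ∘ bd q) = {(cE x a 0).1, (cE x (nx a 0) 1).1, (cE x (nx a 1) 0).1, (cE x a 1).1}))) → ∃ cK : ℕ → Fin 5 → ℕ × ℕ → ℕ, let st := fun e : ℕ × Bool => if e.2 then σ e.1 else τ e.1; let Γ := SimpleGraph.fromRel fun a b : ℕ => ∃ e ∈ E, σ e = a ∧ τ e = b; let dg := fun x : ℕ => (E.filter fun e => σ e = x ∨ τ e = x).card; let K := V.filter fun x =>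 dg x = 5; let R := k / 2; let P := fun (c : ℕ) (s : Fin 5) (a b : ℕ) => if a = 0 ∧ b = 0 then c else if a = 0 then cK c (s + 1) (b, 0) else cK c s (a, b); ∀ c ∈ K, (∀ (s : Fin 5) (a b : ℕ), a ≤ R → b ≤ R → P c s a b ∈ V) ∧ (∀ (s : Fin 5) (a b : ℕ), 1 ≤ a → a ≤ R → b ≤ R → cK c s (a, b) ≠ c) ∧ (∀ (s s' : Fin 5) (a a' b b' : ℕ), 1 ≤ a → a ≤ R → b ≤ R → 1 ≤ a' → a' ≤ R → b' ≤ R → cK c s (a, b) = cK c s' (a', b') → s = s' ∧ a = a' ∧ b = b') ∧ (∀ (s : Fin 5) (a b : ℕ), a + 1 ≤ R → b ≤ R → Γ.Adj (P c s a b) (P c s (a + 1) b)) ∧ (∀ (s : Fin 5) (a b : ℕ), a ≤ R → b + 1 ≤ R → Γ.Adj (P c s a b) (P c s a (b + 1))) ∧ (∀ (s : Fin 5) (a b : ℕ), a + 1 ≤ R → b + 1 ≤ R → ∃ q ∈ Q, Finset.univ.image (st ∘ bd q) = {P c s a b, P c s (a + 1) b, P c s a (b + 1), P c s (a + 1) (b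 + 1)}) ∧ (∀ x ∈ V, Γ.dist x c ≤ R → ∃ (s : Fin 5) (a b : ℕ), a + b ≤ R ∧ P c s a b = x)

/-- **Glue.**  `TameCoreUniformityR → ConeChartsOfAdmissible → CurvatureUniformityR`: choose cone charts complex by
complex, then apply the tame crux.  -/
theorem CurvatureUniformityR_of_subs (h₁ : TameCoreUniformityR) (h₂ : ConeChartsOfAdmissible) :
    Summit.QuantumFields.YangMills.Theses.HyperbolicRegulator.CurvatureUniformityR := by
  intro G _ _ _ _ hG r Fam Sp V E Q σ τ bd cV cE Φ hAdm hAnch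
  classical
  have hex : ∀ k j : ℕ, ∃ cK₀ : ℕ → Fin 5 → ℕ × ℕ → ℕ, 8 ≤ k → _ := fun k j => by
    by_cases hk : 8 ≤ k
    · obtain ⟨cK₀, hcK₀⟩ := h₂ k j (V k j) (E k j) (Q k j) (σ k j) (τ k j) (bd k j) (cV k j) (cE k j) hk (hAdm k j hk)
      exact ⟨cK₀, fun _ => hcK₀⟩
    · exact ⟨fun _ _ _ => 0, fun h => (hk h).elim⟩
  choose cK hcK using hex
  exact h₁ G hG r V E Q σ τ bd cV cE cK hAdm (fun k j hk => hcK k j hk) hAnch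

end Summit.QuantumFields.YangMills.Cruxes.CurvatureUniformityR.ConeTameSplit
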